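import Mathlib
import Literature.Analysis.FluidPDE.PressureEquationSlicing
import Literature.Analysis.FluidPDE.FlatSwirlGauge
import Summits.NavierStokesRegularity.NavierStokesRegularity.Theorems.EulerZoomLiouvillePowerGaugeEulerLiouvilleSelfSimilarGauges
import HarnessLib

/-!
# Rung C1 of the crux `EulerZoomLiouville.PowerGaugeEulerLiouville`: the weak pressure Poisson
# equation of the PROFILE of an exactly self-similar member

Route №10 `EulerZoomLiouville` (NavierStokesRegularity), crux E = stmt-NavierStokesRegularity-19832,
tenure rung C1 (exactly self-similar members).  A suitable weak pair of the class solves the Euler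
system in `𝒟'`, hence the pressure Poisson equation `Δp = −∂ᵢ∂ⱼ(uᵢuⱼ)` in `𝒟'` of the slab, and
(tree `IsDistributionalNSSolutionOn.ae_forall_slice_pressure_identity`, Seregin 2014 §6.3) for
a.e. time the SLICE identity `∫ p(t) Δψ = −∫ D²ψ(u(t), u(t))` for all test functions `ψ`.  For an
exactly self-similar member `u(τ) = selfSimilarCollapse γ 0 V τ`,
`p(τ) = selfSimilarCollapsePressure γ 0 P τ`, one good slice and the dilation `y = (−τ₀)^{−γ} x`
give the profile equation:

* `profile_pressure_poisson` — `∫ P Δθ = −∫ D²θ(V, V)` for every `θ ∈ C_c^∞(ℝ³)`, provided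
  `‖V‖² ∈ L¹_loc` and `P ∈ L¹_loc` (both automatic in E's class).

This is the first input of the identification of the pressure profile with the Riesz pressure of
`V` (sequel files), which removes the Riesz-representation hypothesis from the endpoint stratum.

WHAT THIS IS NOT: not NS, not E, not rung C1 — bookkeeping for self-similar members.
-/

noncomputable section

-- flat `Theorems/<Route><Decl>…` files of one crux share the namespace of the crux (tree convention)
set_option linter.dupNamespace false

open MeasureTheory Set Filter Topology Metric Function TopologicalSpace
open scoped ENNReal NNReal InnerProductSpace RealInnerProductSpace Laplacian

namespace Summit.NavierStokesRegularity.NavierStokesRegularity.Theorems.PowerGaugeEulerLiouville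

open Literature.Analysis Literature.Analysis.FunctionSpaces Literature.Analysis.FluidPDE

section Dilation

/-- Local integrability is preserved by the dilations `x ↦ d • x`, `d ≠ 0`, of `ℝ³`. [folklore] -/
theorem locallyIntegrable_comp_smul {F : Type*} [NormedAddCommGroup F] {g : EuclideanSpace ℝ (Fin 3) → F}
    (hg : LocallyIntegrable g volume) {d : ℝ} (hd : d ≠ 0) :
    LocallyIntegrable (fun x => g (d • x)) volume := by
  set e : EuclideanSpace ℝ (Fin 3) ≃ₜ EuclideanSpace ℝ (Fin 3) := Homeomorph.smulOfNeZero d hd with he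
  have hmap : Measure.map (⇑e) (volume : Measure (EuclideanSpace ℝ (Fin 3))) =
      ENNReal.ofReal (abs ((d ^ Module.finrank ℝ (EuclideanSpace ℝ (Fin 3)))⁻¹)) • volume := by
    rw [show (⇑e) = fun x : EuclideanSpace ℝ (Fin 3) => d • x from rfl]
    exact Measure.map_addHaar_smul volume hd
  have h1 : LocallyIntegrable g (Measure.map (⇑e) (volume : Measure (EuclideanSpace ℝ (Fin 3)))) := by
    rw [hmap, locallyIntegrable_iff]
    intro K hK
    rw [IntegrableOn, Measure.restrict_smul]
    exact (hg.integrableOn_isCompact hK).smul_measure ENNReal.ofReal_ne_top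
  exact (locallyIntegrable_map_homeomorph e).1 h1

/-- Bilinear forms are quadratic along rays: `M(c•w, c•w) = c² M(w, w)`. [folklore] -/
theorem bilin_apply_smul_self (M : EuclideanSpace ℝ (Fin 3) →L[ℝ] EuclideanSpace ℝ (Fin 3) →L[ℝ] ℝ)
    (c : ℝ) (w : EuclideanSpace ℝ (Fin 3)) : M (c • w) (c • w) = c ^ 2 * M w w := by
  rw [map_smul, map_smul]
  change c • (c • (M w w)) = _
  rw [smul_eq_mul, smul_eq_mul]
  ring

end Dilation

section Poisson

variable {u : ℝ → EuclideanSpace ℝ (Fin 3) → EuclideanSpace ℝ (Fin 3)}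
  {p : ℝ → EuclideanSpace ℝ (Fin 3) → ℝ}
  {V : EuclideanSpace ℝ (Fin 3) → EuclideanSpace ℝ (Fin 3)} {P : EuclideanSpace ℝ (Fin 3) → ℝ}
  {γ ν : ℝ}

/-- **The weak pressure Poisson equation of the profile.**  Let `(u, p)` be a suitable weak
(Euler or Navier–Stokes) pair on the slab `(−∞,0) × ℝ³`, `u`, `p` a.e.-strongly measurable
there, exactly self-similar: `u(τ) = selfSimilarCollapse γ 0 V τ`,
`p(τ) = selfSimilarCollapsePressure γ 0 P τ` (`τ < 0`), with `‖V‖² ∈ L¹_loc` and `P ∈ L¹_loc`.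
Then `∫ P Δθ = −∫ D²θ(V, V)` for every `θ ∈ C_c^∞(ℝ³)`: the slice pressure identity of the
distributional solution at one good time `τ₀ ∈ (−2,−1)` (Seregin 2014, §6.3), undone by the
dilation `y = (−τ₀)^{−γ} x`. [cite: Seregin2014, §6.3 (proof of Prop. 3.10)] -/
theorem profile_pressure_poisson
    (hsw : IsSuitableWeakSolutionOn (slab (EuclideanSpace ℝ (Fin 3)) (Iio 0) isOpen_Iio) ν 0 u p)
    (hum : AEStronglyMeasurable (uncurry u)
      (volume.restrict (Iio (0 : ℝ) ×ˢ (univ : Set (EuclideanSpace ℝ (Fin 3))))))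
    (hu : ∀ τ : ℝ, τ < 0 → u τ = selfSimilarCollapse γ 0 V τ)
    (hp : ∀ τ : ℝ, τ < 0 → p τ = selfSimilarCollapsePressure γ 0 P τ)
    (hV2 : LocallyIntegrable (fun y => ‖V y‖ ^ 2) volume) (hP1 : LocallyIntegrable P volume)
    {θ : EuclideanSpace ℝ (Fin 3) → ℝ} (hθ : ContDiff ℝ (⊤ : ℕ∞) θ) (hθc : HasCompactSupport θ) :
    ∫ y, P y * (Δ θ) y = -∫ y, fderiv ℝ (fderiv ℝ θ) y (V y) (V y) := by
  have hVm : AEStronglyMeasurable V volume := aestronglyMeasurable_profile hum hu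
  -- restrict the distributional solution to the product region `(−2,−1) × ℝ³`
  set Q : Opens (ℝ × EuclideanSpace ℝ (Fin 3)) :=
    ⟨Ioo (-2 : ℝ) (-1) ×ˢ ((⊤ : Opens (EuclideanSpace ℝ (Fin 3))) : Set (EuclideanSpace ℝ (Fin 3))),
      isOpen_Ioo.prod (⊤ : Opens (EuclideanSpace ℝ (Fin 3))).isOpen⟩ with hQ
  have hQle : Q ≤ slab (EuclideanSpace ℝ (Fin 3)) (Iio 0) isOpen_Iio := by
    intro z hz
    have hz' : z ∈ Ioo (-2 : ℝ) (-1) ×ˢ ((⊤ : Opens (EuclideanSpace ℝ (Fin 3))) :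
        Set (EuclideanSpace ℝ (Fin 3))) := hz
    have h12 := (mem_prod.1 hz').1.2
    exact mem_slab.2 (show z.1 < 0 by linarith)
  have hns : IsDistributionalNSSolutionOn Q ν 0 u p := hsw.distributional.of_le hQle
  have hslice := IsDistributionalNSSolutionOn.ae_forall_slice_pressure_identity
    (a := -2) (b := -1) (Ω := (⊤ : Opens (EuclideanSpace ℝ (Fin 3)))) hns
    (by
      have e : (uncurry (0 : ℝ → EuclideanSpace ℝ (Fin 3) → EuclideanSpace ℝ (Fin 3))) =
          fun _ => 0 := by funext z; rfl
      rw [e]; exact locallyIntegrableOn_zero) (fun φ _ => by simp)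
  -- a good time
  have hne : (ae ((volume : Measure ℝ).restrict (Ioo (-2 : ℝ) (-1)))).NeBot := by
    rw [ae_neBot, Ne, Measure.restrict_eq_zero, Real.volume_Ioo]; norm_num
  obtain ⟨τ₀, hτ₀, hτ₀I⟩ := (hslice.and (ae_restrict_mem measurableSet_Ioo)).exists
  have hτ₀0 : τ₀ < 0 := by have := hτ₀I.2; linarith
  have hs : 0 < -τ₀ := neg_pos.2 hτ₀0
  set c : ℝ := (-τ₀) ^ (γ - 1) with hc
  set d : ℝ := (-τ₀) ^ (-γ) with hd
  have hc0 : 0 < c := Real.rpow_pos_of_pos hs _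
  have hd0 : 0 < d := Real.rpow_pos_of_pos hs _
  have huτ : u τ₀ = fun x => c • V (d • x) := by
    rw [hu τ₀ hτ₀0]; funext x; rw [selfSimilarCollapse_apply, zero_sub]
  have hpτ : p τ₀ = fun x => (-τ₀) ^ (2 * (γ - 1)) * P (d • x) := by
    rw [hp τ₀ hτ₀0]; funext x; rw [selfSimilarCollapsePressure_apply, zero_sub]
  have hc2 : (-τ₀) ^ (2 * (γ - 1)) = c ^ 2 := by
    rw [hc, ← Real.rpow_natCast ((-τ₀) ^ (γ - 1)) 2, ← Real.rpow_mul hs.le]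
    congr 1; push_cast; ring
  -- the slice side conditions at `τ₀`
  have h1 : AEStronglyMeasurable (u τ₀)
      (volume.restrict ((⊤ : Opens (EuclideanSpace ℝ (Fin 3))) : Set (EuclideanSpace ℝ (Fin 3)))) := by
    rw [Opens.coe_top, Measure.restrict_univ, huτ]
    exact (hVm.comp_quasiMeasurePreserving (quasiMeasurePreserving_smul hd0.ne')).const_smul c
  have h2 : LocallyIntegrableOn (fun x => ‖u τ₀ x‖ ^ 2)
      ((⊤ : Opens (EuclideanSpace ℝ (Fin 3))) : Set (EuclideanSpace ℝ (Fin 3))) volume := by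
    rw [Opens.coe_top, locallyIntegrableOn_univ, huτ]
    have h := (locallyIntegrable_comp_smul hV2 hd0.ne').smul (c ^ 2)
    refine h.congr (Eventually.of_forall fun x => ?_)
    simp only [Pi.smul_apply, smul_eq_mul, norm_smul, Real.norm_eq_abs, abs_of_pos hc0]
    ring
  have h3 : LocallyIntegrableOn (p τ₀)
      ((⊤ : Opens (EuclideanSpace ℝ (Fin 3))) : Set (EuclideanSpace ℝ (Fin 3))) volume := by
    rw [Opens.coe_top, locallyIntegrableOn_univ, hpτ]
    have h := (locallyIntegrable_comp_smul hP1 hd0.ne').smul ((-τ₀) ^ (2 * (γ - 1)))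
    refine h.congr (Eventually.of_forall fun x => ?_)
    simp only [Pi.smul_apply, smul_eq_mul]
  have key := hτ₀ h1 h2 h3
  -- the dilated test function `ψ = θ(d ·)`
  set ψ : EuclideanSpace ℝ (Fin 3) → ℝ := fun x => θ (d • x) with hψ
  have hψT : IsTestFunctionOn (⊤ : Opens (EuclideanSpace ℝ (Fin 3))) ψ :=
    ⟨hθ.comp (contDiff_const_smul d), hθc.comp_smul hd0.ne', by simp⟩
  have hid := key ψ hψT
  -- Laplacian and Hessian of the dilated test function
  have hΔψ : ∀ x, Δ ψ x = d ^ 2 * (Δ θ) (d • x) := fun x => by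
    rw [hψ, laplacian_comp_smul_eq θ d x, smul_eq_mul]
  have hHψ : ∀ x (v : EuclideanSpace ℝ (Fin 3)),
      fderiv ℝ (fderiv ℝ ψ) x v v = d ^ 2 * fderiv ℝ (fderiv ℝ θ) (d • x) v v := fun x v => by
    rw [hψ, fderiv_fderiv_comp_smul θ d]
    rfl
  -- rewrite both sides of the slice identity as dilated profile integrals
  have hvol : |((d ^ Module.finrank ℝ (EuclideanSpace ℝ (Fin 3)))⁻¹)| = (d ^ 3)⁻¹ := by
    rw [finrank_euclideanSpace_fin, abs_of_pos (by positivity)]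
  have hcs1 : ∫ x, P (d • x) * (Δ θ) (d • x) = (d ^ 3)⁻¹ * ∫ y, P y * (Δ θ) y := by
    have h := Measure.integral_comp_smul volume (fun y => P y * (Δ θ) y) d
    simp only [hvol, smul_eq_mul] at h
    exact h
  have hcs2 : ∫ x, fderiv ℝ (fderiv ℝ θ) (d • x) (V (d • x)) (V (d • x)) =
      (d ^ 3)⁻¹ * ∫ y, fderiv ℝ (fderiv ℝ θ) y (V y) (V y) := by
    have h := Measure.integral_comp_smul volume (fun y => fderiv ℝ (fderiv ℝ θ) y (V y) (V y)) d
    simp only [hvol, smul_eq_mul] at h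
    exact h
  have hL : ∫ x, p τ₀ x * Δ ψ x = c ^ 2 * d ^ 2 * ((d ^ 3)⁻¹ * ∫ y, P y * (Δ θ) y) := by
    have e : (fun x => p τ₀ x * Δ ψ x) = fun x => (c ^ 2 * d ^ 2) * (P (d • x) * (Δ θ) (d • x)) := by
      funext x; rw [hpτ, hΔψ, hc2]; ring
    rw [e, integral_const_mul, hcs1]
  have hR : ∫ x, fderiv ℝ (fderiv ℝ ψ) x (u τ₀ x) (u τ₀ x) =
      c ^ 2 * d ^ 2 * ((d ^ 3)⁻¹ * ∫ y, fderiv ℝ (fderiv ℝ θ) y (V y) (V y)) := by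
    have e : (fun x => fderiv ℝ (fderiv ℝ ψ) x (u τ₀ x) (u τ₀ x)) =
        fun x => (c ^ 2 * d ^ 2) * (fderiv ℝ (fderiv ℝ θ) (d • x) (V (d • x)) (V (d • x))) := by
      funext x
      rw [huτ, hHψ, bilin_apply_smul_self]
      ring
    rw [e, integral_const_mul, hcs2]
  rw [hL, hR] at hid
  have hcd : c ^ 2 * d ^ 2 * (d ^ 3)⁻¹ ≠ 0 := by positivity
  have hid' : c ^ 2 * d ^ 2 * (d ^ 3)⁻¹ * ∫ y, P y * (Δ θ) y =
      c ^ 2 * d ^ 2 * (d ^ 3)⁻¹ * (-∫ y, fderiv ℝ (fderiv ℝ θ) y (V y) (V y)) := by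
    linarith
  exact mul_left_cancel₀ hcd hid'

end Poisson

end Summit.NavierStokesRegularity.NavierStokesRegularity.Theorems.PowerGaugeEulerLiouville
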